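import Summits.NavierStokesRegularity.NavierStokesRegularity.Theorems.SqueezeCycleSingularZoomData
import Summits.NavierStokesRegularity.NavierStokesRegularity.Theorems.SqueezeCycleExtremalElementExistsEnergy
import Literature.Analysis.FluidPDE.LocalTypeIReverseZoom
import Literature.Analysis.FluidPDE.TaoEnstrophyLocalisationProofs
import HarnessLib

/-!
# The Type-I zoom sequence of a classical solution at a final-time point
# (route `SqueezeCycle`, item `SingularZoom`, stmt-NavierStokesRegularity-10573), II: local data

Helper file (theorems only). Let `v = α • stPull β R T x₀ u` be the unit-scale viscosity-normalising
zoom of a classical solution about a final-time point, a suitable weak solution of the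
unit-viscosity system in the parabolic ball `Q(0, 1)` in the class of Albritton–Barker Def. 2.1
(`IsSuitableWeakSolutionInBall 1 0 v π`) with weak gradient `Gv` and finite Type-I quantity
`I₀ = 𝐈(Q(0, 1/2); v, π, Gv)` (the tree's `exists_zoom_typeIBound_lt_top_of_morrey`). For the further
zooms `v_c = c • stPull (c²) c 0 0 v`, `0 < c ≤ 1/2`, about the space–time origin this file proves
the analogues of the blow-down lemmas of `LocalTypeIReverseZoom` (Albritton–Barker 2019, §3, with
`Q(0, 1/2)` in place of the half space):

* `abScaledSum_zoomIn_le` — `(A + C + D + E)(Q(z, r); v_c, π_c, ∇v_c) ≤ I₀` whenever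
  `Q(Φ_c z, c r) ⊆ Q(0, 1/2)` (scale invariance);
* `isSuitableWeakSolutionInBall_zoomIn` — with the pressure normalised to mean zero on `B(0, 1)`,
  `(v_c, π_c - [π_c])` satisfies the hypotheses of A–B Lemma 2.2 in `Q(0, 1)`;
* `eLpNorm_zoomIn_velocity_le`, `eLpNorm_zoomIn_pressure_le` — the uniform bounds
  `‖v_c‖_{L³(Q(0,1))} ≤ I₀^{1/3}`, `‖π_c - [π_c]‖_{L^{3/2}(Q(0,1))} ≤ I₀^{2/3}`;
* `setIntegral_setIntegral_norm_sq_le_toReal`, `zoomIn_gradEnergy_le` — the dissipation bound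
  `E ≤ I₀` read as a bound on the iterated Bochner integral `r⁻¹ ∫∫_{Q(z,r)} ‖∇v_c‖²` for a
  jointly `C¹` zoom (Tonelli).
-/

noncomputable section

open MeasureTheory Set Function Filter TopologicalSpace Metric
open scoped Topology NNReal ENNReal InnerProductSpace RealInnerProductSpace

namespace Summit.NavierStokesRegularity.NavierStokesRegularity.Theorems

open Literature.Analysis Literature.Analysis.FluidPDE

/-! ### From space–time `L²` bounds to iterated Bochner integrals -/

section Tonelli

variable {F : Type*} [NormedAddCommGroup F]

/-- **An iterated Bochner integral of `‖h‖²` over a cylinder is dominated by the space–time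
lower integral**: if `(t, y) ↦ h t y` is continuous on `S × ℝ³`, `S` open, `[a, b] ⊆ S`, and
`∫⁻_{(a,b) × B(x₁, r)} ‖h‖ₑ² ≤ B < ∞`, then `∫_{(a,b)} ∫_{B(x₁,r)} ‖h t y‖² dy dt ≤ B.toReal`
(Tonelli; both inner and outer integrands are continuous, hence integrable). [folklore] -/
theorem setIntegral_setIntegral_norm_sq_le_toReal {h : ℝ → EuclideanSpace ℝ (Fin 3) → F}
    {S : Set ℝ} (hS : IsOpen S) {a b : ℝ} (hab : Icc a b ⊆ S)
    (hh : ContinuousOn (uncurry h) (S ×ˢ univ)) (x₁ : EuclideanSpace ℝ (Fin 3)) (r : ℝ)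
    {B : ℝ≥0∞}
    (hB : ∫⁻ z in Ioo a b ×ˢ ball x₁ r, ‖h z.1 z.2‖ₑ ^ 2 ≤ B) (hBtop : B ≠ ⊤) :
    ∫ t in Ioo a b, ∫ y in ball x₁ r, ‖h t y‖ ^ 2 ≤ B.toReal := by
  -- continuity of the slices and of the inner integral
  have hslice : ∀ t ∈ S, Continuous (h t) := fun t ht =>
    hh.comp_continuous (continuous_const.prodMk continuous_id) fun x => ⟨ht, mem_univ x⟩
  have hΦc : ContinuousOn (fun t => ∫ y in ball x₁ r, ‖h t y‖ ^ 2) S :=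
    continuousOn_setIntegral_ball_norm_sq_of_continuousOn hS hh x₁ r
  have hint : ∀ t ∈ S, IntegrableOn (fun y => ‖h t y‖ ^ 2) (ball x₁ r) volume := fun t ht =>
    (((hslice t ht).norm.pow 2).continuousOn.integrableOn_compact (isCompact_closedBall x₁ r)).mono_set
      ball_subset_closedBall
  -- the inner integrals as lower integrals
  have hinner : ∀ t ∈ S, ENNReal.ofReal (∫ y in ball x₁ r, ‖h t y‖ ^ 2) =
      ∫⁻ y in ball x₁ r, ‖h t y‖ₑ ^ 2 := by
    intro t ht
    rw [ofReal_integral_eq_lintegral_ofReal (hint t ht) (Eventually.of_forall fun y => by positivity)]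
    refine lintegral_congr fun y => ?_
    rw [← ofReal_norm, ENNReal.ofReal_pow (norm_nonneg _)]
  -- the outer integral as a lower integral
  have hΦint : IntegrableOn (fun t => ∫ y in ball x₁ r, ‖h t y‖ ^ 2) (Ioo a b) volume :=
    ((hΦc.mono hab).integrableOn_compact isCompact_Icc).mono_set Ioo_subset_Icc_self
  have hΦ0 : 0 ≤ᵐ[volume.restrict (Ioo a b)] fun t => ∫ y in ball x₁ r, ‖h t y‖ ^ 2 :=
    Eventually.of_forall fun t => setIntegral_nonneg measurableSet_ball fun y _ => by positivity
  rw [integral_eq_lintegral_of_nonneg_ae hΦ0 hΦint.aestronglyMeasurable]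
  refine ENNReal.toReal_mono hBtop (le_trans (le_of_eq ?_) hB)
  -- Tonelli
  have hcongr : ∫⁻ t in Ioo a b, ENNReal.ofReal (∫ y in ball x₁ r, ‖h t y‖ ^ 2) =
      ∫⁻ t in Ioo a b, ∫⁻ y in ball x₁ r, ‖h t y‖ₑ ^ 2 :=
    setLIntegral_congr_fun measurableSet_Ioo fun t ht => hinner t (hab (Ioo_subset_Icc_self ht))
  rw [hcongr]
  have hmeas : AEMeasurable (fun z : ℝ × EuclideanSpace ℝ (Fin 3) => ‖h z.1 z.2‖ₑ ^ 2)
      ((volume.restrict (Ioo a b)).prod (volume.restrict (ball x₁ r))) := by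
    rw [Measure.prod_restrict, ← Measure.volume_eq_prod]
    have hc : ContinuousOn (fun z : ℝ × EuclideanSpace ℝ (Fin 3) => ‖h z.1 z.2‖ₑ ^ 2)
        (Ioo a b ×ˢ ball x₁ r) :=
      (ENNReal.continuous_pow 2).comp_continuousOn
        (hh.mono (prod_mono (Ioo_subset_Icc_self.trans hab) (subset_univ _))).enorm
    exact hc.aemeasurable (measurableSet_Ioo.prod measurableSet_ball)
  rw [← lintegral_prod _ hmeas, Measure.prod_restrict, ← Measure.volume_eq_prod]

end Tonelli
/-! ### Zooming in on a local Type-I suitable weak solution in the unit parabolic ball -/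

section ZoomIn

variable {v : ℝ → EuclideanSpace ℝ (Fin 3) → EuclideanSpace ℝ (Fin 3)}
  {π : ℝ → EuclideanSpace ℝ (Fin 3) → ℝ}
  {Gv : ℝ → EuclideanSpace ℝ (Fin 3) → EuclideanSpace ℝ (Fin 3) →L[ℝ] EuclideanSpace ℝ (Fin 3)}
  {c : ℝ}

/-- The zoom about the origin fixes the origin. [folklore] -/
theorem stAffine_sq_zero_zero (c : ℝ) :
    stAffine (c ^ 2) c 0 (0 : EuclideanSpace ℝ (Fin 3)) 0 = 0 := by
  simp [stAffine, Prod.ext_iff]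

/-- For `0 < c ≤ 1` the unit parabolic ball lies in its own zoomed preimage `Q(0, 1/c)`. [folklore] -/
theorem parabolicCylinderOpens_one_le_stPreimage (hc : 0 < c) (hc1 : c ≤ 1) :
    parabolicCylinderOpens 1 (0 : ℝ × EuclideanSpace ℝ (Fin 3)) ≤
      stPreimage (c ^ 2) c 0 0 (parabolicCylinderOpens 1 (0 : ℝ × EuclideanSpace ℝ (Fin 3))) := by
  intro z hz
  show stAffine (c ^ 2) c 0 0 z ∈ (parabolicCylinderOpens 1 (0 : ℝ × EuclideanSpace ℝ (Fin 3)) :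
    Set (ℝ × EuclideanSpace ℝ (Fin 3)))
  rw [coe_parabolicCylinderOpens, ← mem_preimage, stAffine_preimage_parabolicCylinder_zero hc 1]
  exact SuitableCompactness.parabolicCylinder_zero_mono zero_le_one
    (by rw [le_div_iff₀ hc]; linarith) hz

/-- **The zoomed pair is a suitable weak solution in the unit parabolic ball** (`0 < c ≤ 1`;
covariance `IsSuitableWeakSolutionOn.stRescale` with `α = γ = c`, `β = c²`, unit viscosity,
zero force, restricted from `Q(0, 1/c)` to `Q(0, 1)`). [folklore] -/
theorem zoomIn_isSuitableWeakSolutionOn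
    (hsw : IsSuitableWeakSolutionOn (parabolicCylinderOpens 1 (0 : ℝ × EuclideanSpace ℝ (Fin 3)))
      1 0 v π) (hc : 0 < c) (hc1 : c ≤ 1) :
    IsSuitableWeakSolutionOn (parabolicCylinderOpens 1 (0 : ℝ × EuclideanSpace ℝ (Fin 3))) 1 0
      (c • stPull (c ^ 2) c 0 0 v) (c ^ 2 • stPull (c ^ 2) c 0 0 π) := by
  have h := hsw.stRescale hc hc (sq c) 0 0
  have e1 : c * 1 / c = 1 := by field_simp
  have e2 : ((c ^ 2 * c) • stPull (c ^ 2) c 0 (0 : EuclideanSpace ℝ (Fin 3))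
      (0 : ℝ → EuclideanSpace ℝ (Fin 3) → EuclideanSpace ℝ (Fin 3))) = 0 := by
    funext t x; simp [stPull]
  rw [e1, e2] at h
  exact h.of_le (parabolicCylinderOpens_one_le_stPreimage hc hc1)

/-- The zoomed weak spatial gradient `∇v_c = c² (∇v) ∘ Φ_c` on the unit parabolic ball. [folklore] -/
theorem zoomIn_hasWeakSpatialGradientOn
    (hwg : HasWeakSpatialGradientOn (parabolicCylinderOpens 1 (0 : ℝ × EuclideanSpace ℝ (Fin 3))) v Gv)
    (hc : 0 < c) (hc1 : c ≤ 1) :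
    HasWeakSpatialGradientOn (parabolicCylinderOpens 1 (0 : ℝ × EuclideanSpace ℝ (Fin 3)))
      (c • stPull (c ^ 2) c 0 0 v) (c ^ 2 • stPull (c ^ 2) c 0 0 Gv) := by
  have h := hwg.stRescale c (by positivity : 0 < c ^ 2) hc 0 0
  rw [← sq] at h
  exact h.mono (parabolicCylinderOpens_one_le_stPreimage hc hc1)

/-- **The Type-I bound is inherited by the zoomed triple**: for every ball `Q(z, r)` whose image
`Q(Φ_c z, c r)` lies in `Q(0, 1/2)`, `(A + C + D + E)(Q(z, r); v_c, π_c, ∇v_c) ≤ 𝐈(Q(0, 1/2); v)`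
(scale invariance, `abScaledSum_nsZoom`; A–B §3, (3.3)). [cite: AlbrittonBarker2019, §3] -/
theorem abScaledSum_zoomIn_le (hc : 0 < c) {r : ℝ} (hr : 0 < r) {z : ℝ × EuclideanSpace ℝ (Fin 3)}
    (hz : parabolicCylinder (c * r) (stAffine (c ^ 2) c 0 0 z) ⊆
      parabolicCylinder (1 / 2) (0 : ℝ × EuclideanSpace ℝ (Fin 3))) :
    abScaledSum r z (c • stPull (c ^ 2) c 0 0 v) (c ^ 2 • stPull (c ^ 2) c 0 0 π)
        (c ^ 2 • stPull (c ^ 2) c 0 0 Gv) ≤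
      typeIBound (parabolicCylinder (1 / 2) (0 : ℝ × EuclideanSpace ℝ (Fin 3))) v π Gv := by
  rw [abScaledSum_nsZoom hc hr]
  exact abScaledSum_le_typeIBound (mul_pos hc hr) hz

/-- For `0 < c ≤ 1/2` the image of the unit ball, `Q(0, c)`, lies in `Q(0, 1/2)`. [folklore] -/
theorem parabolicCylinder_zoomIn_one_subset (hc : 0 < c) (hc2 : c ≤ 1 / 2) :
    parabolicCylinder (c * 1) (stAffine (c ^ 2) c 0 0 (0 : ℝ × EuclideanSpace ℝ (Fin 3))) ⊆
      parabolicCylinder (1 / 2) (0 : ℝ × EuclideanSpace ℝ (Fin 3)) := by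
  rw [mul_one, stAffine_sq_zero_zero]
  exact SuitableCompactness.parabolicCylinder_zero_mono hc.le hc2

/-- The zoomed pressure lies in `L^{3/2}(Q(0, 1))`: `Q(0, 1) = Φ_c⁻¹(Q(0, c))` and
`∫_{Q(0,1)} |π_c|^{3/2} = c⁻² ∫_{Q(0,c)} |π|^{3/2} ≤ c⁻² ∫_{Q(0,1)} |π|^{3/2} < ∞`. [folklore] -/
theorem memLp_zoomIn_pressure
    (hsw : IsSuitableWeakSolutionOn (parabolicCylinderOpens 1 (0 : ℝ × EuclideanSpace ℝ (Fin 3)))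
      1 0 v π)
    (hπ : MemLp (uncurry π) (3 / 2)
      (volume.restrict (parabolicCylinder 1 (0 : ℝ × EuclideanSpace ℝ (Fin 3)))))
    (hc : 0 < c) (hc1 : c ≤ 1) :
    MemLp (uncurry (c ^ 2 • stPull (c ^ 2) c 0 0 π)) (3 / 2)
      (volume.restrict (parabolicCylinder 1 (0 : ℝ × EuclideanSpace ℝ (Fin 3)))) := by
  obtain ⟨h32, h32', h32r⟩ := threeHalves_facts
  have hsuit := zoomIn_isSuitableWeakSolutionOn hsw hc hc1
  refine ⟨hsuit.distributional.2.2.1.aestronglyMeasurable, ?_⟩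
  rw [eLpNorm_eq_lintegral_rpow_enorm_toReal (zero_lt_one.trans_le h32).ne' h32', h32r]
  refine ENNReal.rpow_lt_top_of_nonneg (by positivity) (ne_of_lt ?_)
  have hQ : parabolicCylinder 1 (0 : ℝ × EuclideanSpace ℝ (Fin 3)) =
      stAffine (c ^ 2) c 0 0 ⁻¹' parabolicCylinder c (0 : ℝ × EuclideanSpace ℝ (Fin 3)) := by
    rw [stAffine_preimage_parabolicCylinder_zero hc c, div_self hc.ne']
  rw [hQ]
  show ∫⁻ z in stAffine (c ^ 2) c 0 0 ⁻¹' parabolicCylinder c (0 : ℝ × EuclideanSpace ℝ (Fin 3)),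
      ‖(c ^ 2 • stPull (c ^ 2) c 0 0 π) z.1 z.2‖ₑ ^ (3 / 2 : ℝ) < ⊤
  rw [setLIntegral_enorm_rpow_stRescale (by positivity : 0 < c ^ 2) hc 0 0 (c ^ 2) π _ (by norm_num)]
  refine ENNReal.mul_lt_top (ENNReal.mul_lt_top
    (ENNReal.rpow_lt_top_of_nonneg (by norm_num) enorm_ne_top) ENNReal.ofReal_lt_top) ?_
  have hfin := hπ.eLpNorm_lt_top
  rw [eLpNorm_eq_lintegral_rpow_enorm_toReal (zero_lt_one.trans_le h32).ne' h32', h32r] at hfin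
  refine lt_of_le_of_lt (lintegral_mono_set
    (SuitableCompactness.parabolicCylinder_zero_mono hc.le hc1)) ?_
  exact (ENNReal.rpow_lt_top_iff_of_pos (by norm_num)).1 hfin

/-- The time-dependent mean over `B(0, 1)` of the zoomed pressure is in `L^{3/2}(Q(0, 1))`.
[folklore] -/
theorem memLp_zoomIn_pressure_mean
    (hsw : IsSuitableWeakSolutionOn (parabolicCylinderOpens 1 (0 : ℝ × EuclideanSpace ℝ (Fin 3)))
      1 0 v π)
    (hπ : MemLp (uncurry π) (3 / 2)
      (volume.restrict (parabolicCylinder 1 (0 : ℝ × EuclideanSpace ℝ (Fin 3)))))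
    (hc : 0 < c) (hc1 : c ≤ 1) :
    MemLp (fun w : ℝ × EuclideanSpace ℝ (Fin 3) =>
        ⨍ y in ball (0 : EuclideanSpace ℝ (Fin 3)) 1, (c ^ 2 • stPull (c ^ 2) c 0 0 π) w.1 y)
      (3 / 2) (volume.restrict (parabolicCylinder 1 (0 : ℝ × EuclideanSpace ℝ (Fin 3)))) := by
  obtain ⟨h32, h32', -⟩ := threeHalves_facts
  have hpm := memLp_zoomIn_pressure hsw hπ hc hc1
  have hQ1 : parabolicCylinder 1 (0 : ℝ × EuclideanSpace ℝ (Fin 3)) =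
      Ioo (-1 : ℝ) 0 ×ˢ ball (0 : EuclideanSpace ℝ (Fin 3)) 1 := by
    simp [parabolicCylinder]
  rw [hQ1] at hpm ⊢
  exact memLp_setAverage_slice (measure_ball_pos volume _ one_pos).ne' measure_ball_lt_top.ne
    h32 h32' hpm

/-- **The zoomed triple satisfies the hypotheses of A–B Lemma 2.2 on `Q(0, 1)`** for
`0 < c ≤ 1/2`, with the pressure normalised to mean zero on `B(0, 1)` at each time: a suitable
weak solution in the unit ball with `esssup_t ∫_{B(0,1)} |v_c|² ≤ I₀`, `∫_{Q(0,1)} |∇v_c|² ≤ I₀ < ∞`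
and pressure in `L^{3/2}(Q(0, 1))` (A–B §3, the estimate (3.3) for the rescaled sequence).
[cite: AlbrittonBarker2019, §3] -/
theorem isSuitableWeakSolutionInBall_zoomIn
    (hball : IsSuitableWeakSolutionInBall 1 0 v π)
    (hwg : HasWeakSpatialGradientOn (parabolicCylinderOpens 1 (0 : ℝ × EuclideanSpace ℝ (Fin 3))) v Gv)
    (hI : typeIBound (parabolicCylinder (1 / 2) (0 : ℝ × EuclideanSpace ℝ (Fin 3))) v π Gv ≠ ∞)
    (hc : 0 < c) (hc2 : c ≤ 1 / 2) :
    IsSuitableWeakSolutionInBall 1 0 (c • stPull (c ^ 2) c 0 0 v)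
      (fun t x => (c ^ 2 • stPull (c ^ 2) c 0 0 π) t x -
        ⨍ y in ball (0 : EuclideanSpace ℝ (Fin 3)) 1, (c ^ 2 • stPull (c ^ 2) c 0 0 π) t y) := by
  obtain ⟨h32, h32', h32r⟩ := threeHalves_facts
  obtain ⟨hsw, -, -, hπ⟩ := hball
  have hc1 : c ≤ 1 := hc2.trans (by norm_num)
  set I := typeIBound (parabolicCylinder (1 / 2) (0 : ℝ × EuclideanSpace ℝ (Fin 3))) v π Gv
    with hIdef
  have hsuit1 := zoomIn_isSuitableWeakSolutionOn hsw hc hc1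
  have hwg1 := zoomIn_hasWeakSpatialGradientOn hwg hc hc1
  have hbound : abScaledSum 1 0 (c • stPull (c ^ 2) c 0 0 v) (c ^ 2 • stPull (c ^ 2) c 0 0 π)
      (c ^ 2 • stPull (c ^ 2) c 0 0 Gv) ≤ I :=
    abScaledSum_zoomIn_le hc one_pos (parabolicCylinder_zoomIn_one_subset hc hc2)
  have hpm := memLp_zoomIn_pressure hsw hπ hc hc1
  have hmean := memLp_zoomIn_pressure_mean hsw hπ hc hc1
  haveI : IsFiniteMeasure
      (volume.restrict (parabolicCylinder 1 (0 : ℝ × EuclideanSpace ℝ (Fin 3)))) :=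
    ⟨by rw [Measure.restrict_apply_univ]; exact (volume_parabolicCylinder_ne_top 1 0).lt_top⟩
  refine ⟨?_, ?_, ⟨_, hwg1, ?_⟩, hpm.sub hmean⟩
  · refine hsuit1.sub_pressure (IntegrableOn.locallyIntegrableOn (hmean.integrable h32))
      fun K hK _ => ?_
    have hfin := hmean.eLpNorm_lt_top
    rw [eLpNorm_eq_lintegral_rpow_enorm_toReal (zero_lt_one.trans_le h32).ne' h32', h32r] at hfin
    exact lt_of_le_of_lt (lintegral_mono_set hK)
      ((ENNReal.rpow_lt_top_iff_of_pos (by norm_num)).1 hfin)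
  · refine ⟨I.toNNReal, ?_⟩
    have hA := cknAEss_le_abScaledSum.trans hbound
    unfold cknAEss at hA
    simp only [ENNReal.ofReal_one, inv_one, one_mul] at hA
    filter_upwards [ENNReal.ae_le_essSup fun t : ℝ =>
      ∫⁻ x in ball (0 : ℝ × EuclideanSpace ℝ (Fin 3)).2 1,
        ‖(c • stPull (c ^ 2) c 0 0 v) t x‖ₑ ^ 2]
      with t ht
    rw [ENNReal.coe_toNNReal hI]
    exact ht.trans hA
  · have hE := cknE_le_abScaledSum.trans hbound
    unfold cknE at hE
    rw [ENNReal.ofReal_one, inv_one, one_mul] at hE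
    exact lt_of_le_of_lt hE hI.lt_top

/-- **Uniform `L³` bound of the zoomed velocities on `Q(0, 1)`** (`0 < c ≤ 1/2`):
`‖v_c‖_{L³(Q(0,1))} ≤ I₀^{1/3}` (`‖v_c‖³_{L³} = C(Q(0,1); v_c) ≤ I₀`; A–B (3.3)). [cite: AlbrittonBarker2019, §3] -/
theorem eLpNorm_zoomIn_velocity_le (hc : 0 < c) (hc2 : c ≤ 1 / 2)
    (π : ℝ → EuclideanSpace ℝ (Fin 3) → ℝ)
    (Gv : ℝ → EuclideanSpace ℝ (Fin 3) → EuclideanSpace ℝ (Fin 3) →L[ℝ] EuclideanSpace ℝ (Fin 3)) :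
    eLpNorm (uncurry (c • stPull (c ^ 2) c 0 0 v)) 3
        (volume.restrict (parabolicCylinder 1 (0 : ℝ × EuclideanSpace ℝ (Fin 3)))) ≤
      typeIBound (parabolicCylinder (1 / 2) (0 : ℝ × EuclideanSpace ℝ (Fin 3))) v π Gv ^
        (1 / 3 : ℝ) := by
  have hC : cknC 1 0 (c • stPull (c ^ 2) c 0 0 v) ≤
      typeIBound (parabolicCylinder (1 / 2) (0 : ℝ × EuclideanSpace ℝ (Fin 3))) v π Gv :=
    (cknC_le_abScaledSum (p := c ^ 2 • stPull (c ^ 2) c 0 0 π)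
      (G := c ^ 2 • stPull (c ^ 2) c 0 0 Gv)).trans
      (abScaledSum_zoomIn_le hc one_pos (parabolicCylinder_zoomIn_one_subset hc hc2))
  unfold cknC at hC
  rw [ENNReal.ofReal_one, one_pow, inv_one, one_mul] at hC
  rw [eLpNorm_eq_lintegral_rpow_enorm_toReal (by norm_num) (by norm_num), ENNReal.toReal_ofNat]
  refine ENNReal.rpow_le_rpow ?_ (by norm_num)
  refine le_of_eq_of_le (lintegral_congr fun w => ?_) hC
  show ‖(c • stPull (c ^ 2) c 0 0 v) w.1 w.2‖ₑ ^ (3 : ℝ) = ‖(c • stPull (c ^ 2) c 0 0 v) w.1 w.2‖ₑ ^ (3 : ℕ)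
  rw [← ENNReal.rpow_natCast]
  norm_num

/-- **Uniform `L^{3/2}` bound of the normalised zoomed pressures on `Q(0, 1)`** (`0 < c ≤ 1/2`):
`‖π_c - [π_c]_{B(0,1)}‖_{L^{3/2}(Q(0,1))} ≤ I₀^{2/3}` (A–B (3.3)). [cite: AlbrittonBarker2019, §3] -/
theorem eLpNorm_zoomIn_pressure_le (hc : 0 < c) (hc2 : c ≤ 1 / 2)
    (v : ℝ → EuclideanSpace ℝ (Fin 3) → EuclideanSpace ℝ (Fin 3))
    (Gv : ℝ → EuclideanSpace ℝ (Fin 3) → EuclideanSpace ℝ (Fin 3) →L[ℝ] EuclideanSpace ℝ (Fin 3)) :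
    eLpNorm (uncurry fun t x => (c ^ 2 • stPull (c ^ 2) c 0 0 π) t x -
        ⨍ y in ball (0 : EuclideanSpace ℝ (Fin 3)) 1, (c ^ 2 • stPull (c ^ 2) c 0 0 π) t y)
        (3 / 2)
        (volume.restrict (parabolicCylinder 1 (0 : ℝ × EuclideanSpace ℝ (Fin 3)))) ≤
      typeIBound (parabolicCylinder (1 / 2) (0 : ℝ × EuclideanSpace ℝ (Fin 3))) v π Gv ^
        (2 / 3 : ℝ) := by
  obtain ⟨h32, h32', h32r⟩ := threeHalves_facts
  have hD : cknDOsc 1 0 (c ^ 2 • stPull (c ^ 2) c 0 0 π) ≤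
      typeIBound (parabolicCylinder (1 / 2) (0 : ℝ × EuclideanSpace ℝ (Fin 3))) v π Gv :=
    (cknDOsc_le_abScaledSum (u := c • stPull (c ^ 2) c 0 0 v)
      (G := c ^ 2 • stPull (c ^ 2) c 0 0 Gv)).trans
      (abScaledSum_zoomIn_le hc one_pos (parabolicCylinder_zoomIn_one_subset hc hc2))
  unfold cknDOsc at hD
  rw [ENNReal.ofReal_one, one_pow, inv_one, one_mul] at hD
  rw [eLpNorm_eq_lintegral_rpow_enorm_toReal (zero_lt_one.trans_le h32).ne' h32', h32r,
    show (1 / (3 / 2 : ℝ)) = 2 / 3 by norm_num]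
  refine ENNReal.rpow_le_rpow ?_ (by norm_num)
  refine le_of_eq_of_le (lintegral_congr fun w => ?_) hD
  simp only [uncurry, Prod.snd_zero]

/-- **The dissipation bound `E ≤ I₀` for a `C¹` zoom, as a bound on iterated Bochner integrals.**
If `(t, y) ↦ v_c t y` is jointly `C¹` on `S × ℝ³` with `S` open, `[t₀ - r², t₀] ⊆ S`, the weak
gradient `∇v_c = c² (∇v) ∘ Φ_c` agrees with the classical one on `(t₀ - r², t₀) × ℝ³`, and
`Q(Φ_c z, c r) ⊆ Q(0, 1/2)` for `z = (t₀, x₁)`, then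
`r⁻¹ ∫_{(t₀-r²,t₀)} ∫_{B(x₁,r)} ‖∇v_c‖² ≤ I₀.toReal` (`‖L‖² ≤ |L|²_F`, `E(Q(z,r)) ≤ I₀`, Tonelli).
[cite: AlbrittonBarker2019, §1 (the quantity E) and §3] -/
theorem zoomIn_gradEnergy_le (hc : 0 < c)
    (hI : typeIBound (parabolicCylinder (1 / 2) (0 : ℝ × EuclideanSpace ℝ (Fin 3))) v π Gv ≠ ∞)
    {S : Set ℝ} (hS : IsOpen S) {t₀ r : ℝ} (hr : 0 < r) (hsub : Icc (t₀ - r ^ 2) t₀ ⊆ S)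
    {x₁ : EuclideanSpace ℝ (Fin 3)}
    (hD : ContinuousOn (fun z : ℝ × EuclideanSpace ℝ (Fin 3) =>
      fderiv ℝ ((c • stPull (c ^ 2) c 0 0 v) z.1) z.2) (S ×ˢ univ))
    (hG : ∀ t ∈ Ioo (t₀ - r ^ 2) t₀, ∀ y,
      (c ^ 2 • stPull (c ^ 2) c 0 0 Gv) t y = fderiv ℝ ((c • stPull (c ^ 2) c 0 0 v) t) y)
    (hz : parabolicCylinder (c * r) (stAffine (c ^ 2) c 0 0 ((t₀, x₁) : ℝ × EuclideanSpace ℝ (Fin 3))) ⊆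
      parabolicCylinder (1 / 2) (0 : ℝ × EuclideanSpace ℝ (Fin 3))) :
    r⁻¹ * ∫ t in Ioo (t₀ - r ^ 2) t₀, ∫ y in ball x₁ r,
        ‖fderiv ℝ ((c • stPull (c ^ 2) c 0 0 v) t) y‖ ^ 2 ≤
      (typeIBound (parabolicCylinder (1 / 2) (0 : ℝ × EuclideanSpace ℝ (Fin 3))) v π Gv).toReal := by
  set I := typeIBound (parabolicCylinder (1 / 2) (0 : ℝ × EuclideanSpace ℝ (Fin 3))) v π Gv with hIdef
  -- `E(Q(z, r); ∇v_c) ≤ I`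
  have hE : cknE r ((t₀, x₁) : ℝ × EuclideanSpace ℝ (Fin 3)) (c ^ 2 • stPull (c ^ 2) c 0 0 Gv) ≤ I :=
    (cknE_le_abScaledSum (u := c • stPull (c ^ 2) c 0 0 v) (p := c ^ 2 • stPull (c ^ 2) c 0 0 π)).trans
      (abScaledSum_zoomIn_le hc hr hz)
  unfold cknE at hE
  have hr0 : ENNReal.ofReal r ≠ 0 := (ENNReal.ofReal_pos.2 hr).ne'
  -- the space–time bound on `‖∇v_c‖ₑ²` over the cylinder
  have hQ : parabolicCylinder r ((t₀, x₁) : ℝ × EuclideanSpace ℝ (Fin 3)) = Ioo (t₀ - r ^ 2) t₀ ×ˢ ball x₁ r :=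
    rfl
  have hB : ∫⁻ z in Ioo (t₀ - r ^ 2) t₀ ×ˢ ball x₁ r,
      ‖fderiv ℝ ((c • stPull (c ^ 2) c 0 0 v) z.1) z.2‖ₑ ^ 2 ≤ ENNReal.ofReal r * I := by
    have h1 : ∫⁻ z in Ioo (t₀ - r ^ 2) t₀ ×ˢ ball x₁ r,
        ‖fderiv ℝ ((c • stPull (c ^ 2) c 0 0 v) z.1) z.2‖ₑ ^ 2 ≤
        ∫⁻ z in parabolicCylinder r ((t₀, x₁) : ℝ × EuclideanSpace ℝ (Fin 3)),
          ENNReal.ofReal (frobeniusNormSq ((c ^ 2 • stPull (c ^ 2) c 0 0 Gv) z.1 z.2)) := by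
      rw [hQ]
      refine setLIntegral_mono' (measurableSet_Ioo.prod measurableSet_ball) fun z hz' => ?_
      rw [hG z.1 hz'.1 z.2, ← ofReal_norm, ← ENNReal.ofReal_pow (norm_nonneg _)]
      exact ENNReal.ofReal_le_ofReal (sq_opNorm_le_frobeniusNormSq _)
    refine h1.trans ?_
    calc ∫⁻ z in parabolicCylinder r ((t₀, x₁) : ℝ × EuclideanSpace ℝ (Fin 3)),
          ENNReal.ofReal (frobeniusNormSq ((c ^ 2 • stPull (c ^ 2) c 0 0 Gv) z.1 z.2))
        = ENNReal.ofReal r * ((ENNReal.ofReal r)⁻¹ *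
            ∫⁻ z in parabolicCylinder r ((t₀, x₁) : ℝ × EuclideanSpace ℝ (Fin 3)),
              ENNReal.ofReal (frobeniusNormSq ((c ^ 2 • stPull (c ^ 2) c 0 0 Gv) z.1 z.2))) := by
          rw [← mul_assoc, ENNReal.mul_inv_cancel hr0 ENNReal.ofReal_ne_top, one_mul]
      _ ≤ ENNReal.ofReal r * I := mul_le_mul' le_rfl hE
  have hBtop : ENNReal.ofReal r * I ≠ ⊤ := ENNReal.mul_ne_top ENNReal.ofReal_ne_top hI
  have key := setIntegral_setIntegral_norm_sq_le_toReal
    (h := fun t y => fderiv ℝ ((c • stPull (c ^ 2) c 0 0 v) t) y) hS hsub hD x₁ r hB hBtop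
  rw [ENNReal.toReal_mul, ENNReal.toReal_ofReal hr.le] at key
  rw [inv_mul_le_iff₀ hr]
  exact key

end ZoomIn

end Summit.NavierStokesRegularity.NavierStokesRegularity.Theorems

end
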